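import Literature.NumberTheory.EllipticCurves.XCubeSub81675ThreeDescentSelmer
import Literature.NumberTheory.EllipticCurves.MordellCurveSqrtThreeDescentCount
import Literature.NumberTheory.EllipticCurves.ShaRestrictionIndex
import Literature.NumberTheory.EllipticCurves.TwoIsogenyShaTwoTorsion
import Literature.NumberTheory.EllipticCurves.SelmerCorankHolds
import Literature.NumberTheory.EllipticCurves.VariableChangePoints
import HarnessLib

/-!
# `y² = x³ − 27·55²` over `ℚ`: `Ш[3] = 0`, rank exactly `2`, `corank Sel_{3^∞} = 2`
# (complete `3`-descent: Cohen–Pazuki 2009, Jeong 2019 — first `3`-descent door at rank `2` in the tree)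

Topic `NumberTheory/EllipticCurves`. Sequel of `XCubeSub81675ThreeDescentSelmer.lean`, which proved
over `K3 = ℚ(ζ₃)` that the `√−3`-Selmer group of `A : y² = x³ − 81675` is the `27`-element box
`⟨[2], [5], [11]⟩ ⊂ K3ˣ/K3ˣ³`, filled by the descent values of rational points, and that
`Ш(A/K3)[3] = 0`. Here, over `ℚ`:

* §1 `XCubeSub81675.curve = mordellCurve (−81675) : y² = x³ − 27·55²` (the `−3`-twist and
  `3`-isogenous partner of `y² = x³ + 55²`; Jeong's `A'_{55}`), its base change to `K3`
  (`baseChange_curve`).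
* §2 **`Ш(A/ℚ)[3] = 0`** (`forall_mem_sha_three_nsmul_eq_zero`): restriction
  `Ш(A/ℚ) → Ш(A/K3)` is injective on `Ш[3]` since `3 ∤ [K3 : ℚ] = 2` (tree
  `shaRestriction_eq_zero_iff_of_coprime`); hence `Ш(A/ℚ)[3^∞] = 0` and
  **`corank_{ℤ₃} Ш(A/ℚ)[3^∞] = 0`** (`shaCorank_three`).
* §3 **`rank A(ℚ) = 2` exactly** (`mordellWeilRank_curve`): the descent classes of
  `A' : Y² = X³ + 1485²` over `K3` form EXACTLY the `27`-element box (upper bound from the Selmer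
  box applied to the classes `[δ(P)]`, which have trivial torsor class; lower bound: the box lies in
  the group of descent classes and its `27` elements are distinct, by `2`-, `5`-, `11`-adic
  valuations), the tree's count `#δ(A'(K3)) = 3^{rank A'(ℚ) + 1}` (`natCard_range_cubicDescentClass_eq`)
  gives `rank (Y² = X³ + 1485²)(ℚ) = 2`, and `A` is `ℚ`-isomorphic (`u = 3`) to the `−3`-twist
  `Y² = X³ − 27·1485²`, of the same rank (`3`-isogeny, `mordellWeilRank_quadraticTwist_neg_three`).
* §4 **`corank_{ℤ₃} Sel_{3^∞}(A/ℚ) = 2 = rank A(ℚ)`** (`selmerCorank_three`, Greenberg's identity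
  `selmerCorank_eq_mordellWeilRank_add_holds`).

So `A` is an elliptic curve over `ℚ` of Mordell–Weil rank `2` with `Ш(A/ℚ)[3^∞] = 0` certified by
descent at the prime `3` — where no Iwasawa theory and no `p`-adic `L`-function is available or
needed (Jeong 2019 proves `rank = 2` for infinitely many `A_{pq}` under parity; here one curve,
unconditionally, together with the `3`-part of `Ш`).

## References

* [CohenPazuki2009] H. Cohen, F. Pazuki, *Elementary 3-descent with a 3-isogeny*, Acta Arith. 140
  (2009) 369–404, Thm. 2.1, §5.
* [Jeong2019RankExactlyTwoII] K. Jeong, *Infinitely many elliptic curves of rank exactly two II*,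
  Proc. Japan Acad. Ser. A 95 (2019) 53–57, §3 (Lemma 3.3, Prop. 3.5).
* [SilvermanAEC2009] J. H. Silverman, *The Arithmetic of Elliptic Curves*, 2nd ed., Thm. X.4.2,
  Remark X.4.7, Exercise 10.9, Exercise 10.16.
* [Greenberg1999LNM] R. Greenberg, *Iwasawa theory for elliptic curves*, LNM 1716, §1 (coranks).
-/

noncomputable section

open scoped Classical WithZero

open WeierstrassCurve IsDedekindDomain IsDedekindDomain.HeightOneSpectrum NumberField
open WithZero (log exp)
open Literature.NumberTheory.NumberFields Literature.NumberTheory.NumberFields.K3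

namespace Literature.NumberTheory.EllipticCurves

namespace XCubeSub81675

/-! ## §1 The curve over `ℚ` and its base change to `K3` -/

/-- **`A : y² = x³ − 81675 = x³ − 27·55²`** over `ℚ` (`[0, 0, 0, 0, −81675]`).
[cite: Jeong2019RankExactlyTwoII, §3] -/
theorem curve_eq : (mordellCurve (-81675 : ℚ)) = ⟨0, 0, 0, 0, -81675⟩ := rfl

/-- `A` is an elliptic curve. [cite: Jeong2019RankExactlyTwoII, §3] -/
theorem isElliptic_curve : (mordellCurve (-81675 : ℚ)).IsElliptic := isElliptic_mordellCurve (by norm_num)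

/-- The base change of `A` to `K3` is `Y² = X³ + (165θ)²`, `θ = √−3`. [cite: Jeong2019RankExactlyTwoII, §3] -/
theorem baseChange_curve :
    (mordellCurve (-81675 : ℚ)).baseChange K3 = mordellCurve ((165 * theta : K3) ^ 2) := by
  rw [mordellCurve_baseChange, mul_pow, theta_sq]
  congr 1
  norm_num

/-! ## §2 `Ш(A/ℚ)[3] = 0` by restriction to `K3` -/

/-- **`Ш(A/ℚ)[3] = 0` for `A : y² = x³ − 27·55²`**: a class of `Ш(A/ℚ)` killed by `3` restricts to
a class of `Ш(A/ℚ(ζ₃))` killed by `3`, which vanishes (complete `√−3`-descent,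
`XCubeSub81675.forall_mem_sha_three_nsmul_eq_zero`); and restriction is injective on `Ш[3]` because
`3` is prime to `[ℚ(ζ₃) : ℚ] = 2` (`shaRestriction_eq_zero_iff_of_coprime`).
[cite: CohenPazuki2009, Thm. 2.1] [cite: Jeong2019RankExactlyTwoII, Prop. 3.5] -/
theorem forall_mem_sha_three_nsmul_eq_zero_rat :
    ∀ c ∈ (mordellCurve (-81675 : ℚ)).sha, 3 • c = 0 → c = 0 := by
  haveI := isElliptic_curve
  haveI : IsGalois ℚ K3 := IsCyclotomicExtension.isGalois {3} ℚ K3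
  intro c hc h3
  have key : ∀ d ∈ ((mordellCurve (-81675 : ℚ)).baseChange K3).sha, 3 • d = 0 → d = 0 := by
    rw [baseChange_curve]
    exact forall_mem_sha_three_nsmul_eq_zero
  set c' : (mordellCurve (-81675 : ℚ)).sha := ⟨c, hc⟩ with hc'
  have h3' : 3 • c' = 0 := Subtype.ext h3
  have hres : shaRestriction (mordellCurve (-81675 : ℚ)) K3 c' = 0 := by
    apply Subtype.ext
    apply key _ (shaRestriction (mordellCurve (-81675 : ℚ)) K3 c').2
    rw [← AddSubgroupClass.coe_nsmul, ← map_nsmul, h3', map_zero]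
    rfl
  have hcop : Nat.Coprime 3 (Module.finrank ℚ K3) := by rw [finrank_eq]; decide
  have := (shaRestriction_eq_zero_iff_of_coprime (mordellCurve (-81675 : ℚ)) K3 hcop c' h3').mp hres
  exact congrArg Subtype.val this

/-- **`Ш(A/ℚ)[3^∞] = 0`.** [cite: CohenPazuki2009, Thm. 2.1] -/
theorem primaryComponent_sha_three :
    AddCommGroup.primaryComponent (mordellCurve (-81675 : ℚ)).sha 3 = ⊥ :=
  haveI : Fact (Nat.Prime 3) := ⟨Nat.prime_three⟩
  primaryComponent_sha_eq_bot_of_forall _ forall_mem_sha_three_nsmul_eq_zero_rat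

/-- **`corank_{ℤ₃} Ш(A/ℚ)[3^∞] = 0`**: the hypothesis of the prime-to-prime transfer `T` /
an instance of the door `O` at `p₀ = 3`. [cite: CohenPazuki2009, Thm. 2.1] [cite: Greenberg1999LNM, §1] -/
theorem shaCorank_three : (mordellCurve (-81675 : ℚ)).shaCorank 3 = 0 :=
  haveI : Fact (Nat.Prime 3) := ⟨Nat.prime_three⟩
  shaCorank_eq_zero_of_forall _ 3 forall_mem_sha_three_nsmul_eq_zero_rat

/-! ## §3 The descent classes of `A' : Y² = X³ + 1485²` over `K3` are exactly the `27`-element box;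
`rank A(ℚ) = 2` -/

/-- Transport of the range of descent classes along an equality of curves. [folklore] -/
private theorem range_cubicDescentClass_congr {F : Type} [Field F] {W₁ W₂ : WeierstrassCurve F} (h : W₁ = W₂)
    (B : F) : Set.range (MordellDescent.cubicDescentClass W₁ B) = Set.range (MordellDescent.cubicDescentClass W₂ B) := by
  subst h; rfl

/-- `A' = E_{81·165²}` is the count theorem's `Y² = X³ + (9·165)²`. [folklore] -/
private theorem curve'_eq : mordellCurve (81 * (165 : K3) ^ 2) = mordellCurve ((9 * (165 : K3)) ^ 2) := by
  congr 1; ring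

/-- The descent classes `[δ(P)]`, `P ∈ A'(K3)`, as classes of `phiDescent 165` and as the count
theorem's `cubicDescentClass (9·165)`: the same set. [folklore] -/
private theorem range_eq_range :
    Set.range (fun P : (mordellCurve (81 * (165 : K3) ^ 2)).toAffine.Point =>
        MordellDescent.cubeClass (MordellDescent.phiDescent (165 : K3) P)) =
      Set.range (MordellDescent.cubicDescentClass (mordellCurve ((9 * (165 : K3)) ^ 2)) (9 * 165)) := by
  rw [← range_cubicDescentClass_congr curve'_eq]
  congr 1
  funext P
  exact MordellDescent.cubeClass_phiDescent 165 P

/-- The box map `(k, l, m) ↦ [2^k 5^l 11^m] ∈ K3ˣ/K3ˣ³`. Notation-free: written out in each statement.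
`[p^k] = [p^{k mod 3}]`. [folklore] -/
private theorem cubeClass_pow_mod {q : K3} (hq : q ≠ 0) (k : ℕ) :
    MordellDescent.cubeClass (q ^ k) = MordellDescent.cubeClass (q ^ (k % 3)) := by
  conv_lhs => rw [← Nat.mod_add_div k 3, pow_add, pow_mul, ← mul_comm]
  rw [mul_comm, show (q ^ 3) ^ (k / 3) = (q ^ (k / 3)) ^ 3 by ring,
    MordellDescent.cubeClass_mul_pow_three (pow_ne_zero _ hq) (pow_ne_zero _ hq)]

/-- `[2^k 5^l 11^m] = [2^{k mod 3} 5^{l mod 3} 11^{m mod 3}]`. [folklore] -/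
private theorem cubeClass_box (k l m : ℕ) :
    MordellDescent.cubeClass ((2 : K3) ^ k * 5 ^ l * 11 ^ m) =
      MordellDescent.cubeClass ((2 : K3) ^ (k % 3) * 5 ^ (l % 3) * 11 ^ (m % 3)) := by
  have h5 : (5 : K3) ≠ 0 := by norm_num
  have h11 : (11 : K3) ≠ 0 := by norm_num
  rw [MordellDescent.cubeClass_mul (mul_ne_zero (pow_ne_zero _ two_ne_zero) (pow_ne_zero _ h5)) (pow_ne_zero _ h11),
    MordellDescent.cubeClass_mul (pow_ne_zero _ two_ne_zero) (pow_ne_zero _ h5),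
    MordellDescent.cubeClass_mul (mul_ne_zero (pow_ne_zero _ two_ne_zero) (pow_ne_zero _ h5)) (pow_ne_zero _ h11),
    MordellDescent.cubeClass_mul (pow_ne_zero _ two_ne_zero) (pow_ne_zero _ h5),
    cubeClass_pow_mod two_ne_zero k, cubeClass_pow_mod h5 l, cubeClass_pow_mod h11 m]

/-- **Upper bound: every descent class of `A'(K3)` lies in the box `{[2^k 5^l 11^m] : k, l, m < 3}`**
(the class `[δ(P)]` has trivial torsor class, `torsorClass_phiDescent`, in particular in `Ш`, so the
Selmer box `exists_cubeClass_eq_of_sha` applies). [cite: Jeong2019RankExactlyTwoII, Prop. 3.5] -/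
theorem range_subset_box :
    Set.range (MordellDescent.cubicDescentClass (mordellCurve ((9 * (165 : K3)) ^ 2)) (9 * 165)) ⊆
      Set.range (fun klm : Fin 3 × Fin 3 × Fin 3 =>
        MordellDescent.cubeClass ((2 : K3) ^ (klm.1 : ℕ) * 5 ^ (klm.2.1 : ℕ) * 11 ^ (klm.2.2 : ℕ))) := by
  rw [← range_eq_range]
  rintro _ ⟨P, rfl⟩
  have ha := MordellDescent.phiDescent_ne_zero hc165 P
  have hsha : MordellDescent.torsorClass hc165 hD165 ha ∈ (mordellCurve ((165 * theta : K3) ^ 2)).sha := by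
    rw [MordellDescent.torsorClass_phiDescent hc165 hD165 P]; exact AddSubgroup.zero_mem _
  obtain ⟨k, l, m, h⟩ := exists_cubeClass_eq_of_sha ha hsha
  refine ⟨(⟨k % 3, Nat.mod_lt _ (by norm_num)⟩, ⟨l % 3, Nat.mod_lt _ (by norm_num)⟩,
    ⟨m % 3, Nat.mod_lt _ (by norm_num)⟩), ?_⟩
  change MordellDescent.cubeClass ((2 : K3) ^ (k % 3) * 5 ^ (l % 3) * 11 ^ (m % 3)) =
    MordellDescent.cubeClass (MordellDescent.phiDescent (165 : K3) P)
  rw [h, show (((2 ^ k * 5 ^ l * 11 ^ m : ℚ)) : K3) = (2 : K3) ^ k * 5 ^ l * 11 ^ m by push_cast; ring]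
  exact (cubeClass_box k l m).symm

/-- The descent classes form a subgroup of `K3ˣ/K3ˣ³` (`δ` is multiplicative, `cubicDescentClass_add`).
[cite: SilvermanAEC2009, X.4 Remark X.4.7] -/
theorem exists_subgroup_range :
    ∃ H : Subgroup (MordellDescent.CubeUnits K3),
      (H : Set (MordellDescent.CubeUnits K3)) =
        Set.range (MordellDescent.cubicDescentClass (mordellCurve ((9 * (165 : K3)) ^ 2)) (9 * 165)) := by
  have h9 : (9 : K3) * 165 ≠ 0 := by norm_num
  refine ⟨{ carrier := Set.range (MordellDescent.cubicDescentClass (mordellCurve ((9 * (165 : K3)) ^ 2)) (9 * 165))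
            mul_mem' := ?_, one_mem' := ⟨0, MordellDescent.cubicDescentClass_zero _⟩, inv_mem' := ?_ }, rfl⟩
  · rintro _ _ ⟨P, rfl⟩ ⟨Q, rfl⟩
    exact ⟨_, MordellDescent.cubicDescentClass_add rfl two_ne_zero h9 P Q⟩
  · rintro _ ⟨P, rfl⟩
    exact ⟨_, eq_inv_of_mul_eq_one_left (MordellDescent.cubicDescentClass_neg_mul rfl two_ne_zero h9 P)⟩

/-- **Lower bound: every box class `[2^k 5^l 11^m]` is a descent class of `A'(K3)`** (the box lies
in the subgroup generated by `[δ(−54,1431)], [δ(99,1782)], [δ(0,1485)]`, and the descent classes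
form a subgroup). [cite: Jeong2019RankExactlyTwoII, §3] -/
theorem box_subset_range :
    Set.range (fun klm : Fin 3 × Fin 3 × Fin 3 =>
        MordellDescent.cubeClass ((2 : K3) ^ (klm.1 : ℕ) * 5 ^ (klm.2.1 : ℕ) * 11 ^ (klm.2.2 : ℕ))) ⊆
      Set.range (MordellDescent.cubicDescentClass (mordellCurve ((9 * (165 : K3)) ^ 2)) (9 * 165)) := by
  obtain ⟨H, hH⟩ := exists_subgroup_range
  rintro _ ⟨⟨k, l, m⟩, rfl⟩
  have hmem := cubeClass_two_five_eleven_pow_mem (k : ℕ) (l : ℕ) (m : ℕ)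
  rw [show (((2 ^ (k : ℕ) * 5 ^ (l : ℕ) * 11 ^ (m : ℕ) : ℚ)) : K3) =
      (2 : K3) ^ (k : ℕ) * 5 ^ (l : ℕ) * 11 ^ (m : ℕ) by push_cast; ring, range_eq_range, ← hH] at hmem
  rw [← hH]
  exact (Subgroup.closure_le H).mpr (fun x hx => hx) hmem

/-- Valuation signature of a box element: `ord₂ = k`, `ord₅ = l`, `ord₁₁ = m` modulo `3`, so the
`27` box classes are distinct. [cite: CohenPazuki2009, Thm. 2.1] -/
theorem box_injective : Function.Injective (fun klm : Fin 3 × Fin 3 × Fin 3 =>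
    MordellDescent.cubeClass ((2 : K3) ^ (klm.1 : ℕ) * 5 ^ (klm.2.1 : ℕ) * 11 ^ (klm.2.2 : ℕ))) := by
  rintro ⟨k, l, m⟩ ⟨k', l', m'⟩ h
  have hne : ∀ a b c : ℕ, (2 : K3) ^ a * 5 ^ b * 11 ^ c ≠ 0 := fun a b c =>
    mul_ne_zero (mul_ne_zero (pow_ne_zero _ two_ne_zero) (pow_ne_zero _ (by norm_num))) (pow_ne_zero _ (by norm_num))
  obtain ⟨w, hw, hww⟩ := (MordellDescent.cubeClass_eq_cubeClass_iff (hne _ _ _) (hne _ _ _)).mp h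
  -- read the normal-form valuations: `x = 1 · ζ^0 · (ζ−1)^0 · 2^a 5^b 11^c · w³`
  have hnf : ∀ (a b c : ℕ) (z : K3), (2 : K3) ^ a * 5 ^ b * 11 ^ c * z ^ 3 =
      ((1 : ℤ) : K3) * zeta ^ 0 * (zeta - 1) ^ 0 * 2 ^ a * 5 ^ b * 11 ^ c * z ^ 3 := by
    intro a b c z; push_cast; ring
  have hlhs : (2 : K3) ^ (k : ℕ) * 5 ^ (l : ℕ) * 11 ^ (m : ℕ) =
      ((1 : ℤ) : K3) * zeta ^ 0 * (zeta - 1) ^ 0 * 2 ^ (k : ℕ) * 5 ^ (l : ℕ) * 11 ^ (m : ℕ) * 1 ^ 3 := by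
    push_cast; ring
  have h2 := congrArg (fun x => log (val prime_natCast_two x)) hww
  have h5 := congrArg (fun x => log (val prime_natCast_five x)) hww
  have h11 := congrArg (fun x => log (val prime_natCast_eleven x)) hww
  simp only at h2 h5 h11
  rw [hlhs, hnf, log_val2_normalForm330 (Or.inl rfl) 0 0 _ _ _ one_ne_zero,
    log_val2_normalForm330 (Or.inl rfl) 0 0 _ _ _ hw, Valuation.map_one, WithZero.log_one] at h2
  rw [hlhs, hnf, log_val5_normalForm330 (Or.inl rfl) 0 0 _ _ _ one_ne_zero,
    log_val5_normalForm330 (Or.inl rfl) 0 0 _ _ _ hw, Valuation.map_one, WithZero.log_one] at h5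
  rw [hlhs, hnf, log_val11_normalForm330 (Or.inl rfl) 0 0 _ _ _ one_ne_zero,
    log_val11_normalForm330 (Or.inl rfl) 0 0 _ _ _ hw, Valuation.map_one, WithZero.log_one] at h11
  have hk := k.isLt; have hl := l.isLt; have hm := m.isLt
  have hk' := k'.isLt; have hl' := l'.isLt; have hm' := m'.isLt
  ext <;> simp only <;> omega

/-- **The descent classes of `A'(K3)` are exactly the `27`-element box.** [cite: Jeong2019RankExactlyTwoII, Prop. 3.5] -/
theorem natCard_range_cubicDescentClass :
    Nat.card (Set.range (MordellDescent.cubicDescentClass (mordellCurve ((9 * (165 : K3)) ^ 2)) (9 * 165))) = 27 := by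
  rw [Set.Subset.antisymm range_subset_box box_subset_range, Nat.card_range_of_injective box_injective]
  simp

/-- **`rank (Y² = X³ + 1485²)(ℚ) = 2`** from the count `#δ(A'(K3)) = 3^{rank + 1}` (tree
`natCard_range_cubicDescentClass_eq`, with `[K3 : ℚ] = 2` and complex conjugation).
[cite: Jeong2019RankExactlyTwoII, §3] [cite: SilvermanAEC2009, X.4 Remark X.4.7] -/
theorem mordellWeilRank_curve' : (mordellCurve ((1485 : ℚ) ^ 2)).mordellWeilRank = 2 := by
  have hσc : conjBar (algebraMap K3 _ (165 : K3)) = algebraMap K3 _ (165 : K3) := by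
    have : ((165 : ℚ) : K3) = 165 := by norm_num
    rw [← this, conjBar_ratCast]
  have hbc : algebraMap ℚ K3 1485 = 9 * 165 := by rw [map_ofNat]; norm_num
  have hcount := SqrtThree.natCard_range_cubicDescentClass_eq (K := K3) finrank_eq theta_sq conjBar
    conjBar_theta hσc (b := 1485) (by norm_num) hbc
  rw [natCard_range_cubicDescentClass, show (27 : ℕ) = 3 ^ (2 + 1) by norm_num] at hcount
  have := Nat.pow_right_injective (by norm_num : 2 ≤ 3) hcount
  omega

/-- `A : y² = x³ − 81675` is the model `u = 3` of the `−3`-twist `Y² = X³ − 27·1485²` of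
`Y² = X³ + 1485²`. [cite: SilvermanAEC2009, X.5 Prop. 5.4] -/
theorem variableChange_curve :
    (⟨Units.mk0 (3 : ℚ) (by norm_num), 0, 0, 0⟩ : VariableChange ℚ) • mordellCurve (-27 * (1485 : ℚ) ^ 2) =
      mordellCurve (-81675 : ℚ) := by
  ext
  · simp [mordellCurve, variableChange_a₁]
  · simp [mordellCurve, variableChange_a₂]
  · simp [mordellCurve, variableChange_a₃]
  · simp [mordellCurve, variableChange_a₄]
  · simp [mordellCurve, variableChange_a₆]
    norm_num

/-- **`rank A(ℚ) = 2` for `A : y² = x³ − 27·55²`**: `A ≅ (Y² = X³ + 1485²)^{(−3)}` over `ℚ`, and the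
`−3`-twist of `Y² = X³ + b²` is `3`-isogenous to it (`mordellWeilRank_quadraticTwist_neg_three`).
[cite: Jeong2019RankExactlyTwoII, §3] -/
theorem mordellWeilRank_curve : (mordellCurve (-81675 : ℚ)).mordellWeilRank = 2 := by
  have hMW : ((⟨Units.mk0 (3 : ℚ) (by norm_num), 0, 0, 0⟩ : VariableChange ℚ) •
      mordellCurve (-27 * (1485 : ℚ) ^ 2)).mordellWeilRank = (mordellCurve (-27 * (1485 : ℚ) ^ 2)).mordellWeilRank :=
    @WeierstrassCurve.VariableChange.finrank_point_variableChange ℚ _ (mordellCurve (-27 * (1485 : ℚ) ^ 2))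
      ⟨Units.mk0 (3 : ℚ) (by norm_num), 0, 0, 0⟩ (Classical.decEq ℚ)
  rw [variableChange_curve] at hMW
  rw [hMW, ← SqrtThree.quadraticTwist_mordellCurve_sq, SqrtThree.mordellWeilRank_quadraticTwist_neg_three (by norm_num),
    mordellWeilRank_curve']

/-! ## §4 `corank_{ℤ₃} Sel_{3^∞}(A/ℚ) = 2` -/

/-- **`corank_{ℤ₃} Sel_{3^∞}(A/ℚ) = rank A(ℚ) = 2`** (Greenberg's identity `corank Sel = rank + corank Ш`,
tree theorem `selmerCorank_eq_mordellWeilRank_add_holds`, with `corank Ш[3^∞] = 0`).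
[cite: Greenberg1999LNM, §1 pp. 54–57] -/
theorem selmerCorank_three : (mordellCurve (-81675 : ℚ)).selmerCorank 3 = 2 := by
  haveI := isElliptic_curve
  haveI : Fact (Nat.Prime 3) := ⟨Nat.prime_three⟩
  rw [(mordellCurve (-81675 : ℚ)).selmerCorank_eq_mordellWeilRank_add_holds 3, shaCorank_three,
    mordellWeilRank_curve]

/-- **Summary** for `A : y² = x³ − 27·55²` over `ℚ`: rank `2`, `Ш[3^∞] = 0`, `corank Ш[3^∞] = 0`,
`corank Sel_{3^∞} = 2` — a rank-`2` elliptic curve whose `3`-primary Tate–Shafarevich group is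
certified trivial by descent. [cite: CohenPazuki2009, Thm. 2.1] [cite: Jeong2019RankExactlyTwoII, Prop. 3.5] -/
theorem rank_two_and_sha_three :
    (mordellCurve (-81675 : ℚ)).mordellWeilRank = 2 ∧
      AddCommGroup.primaryComponent (mordellCurve (-81675 : ℚ)).sha 3 = ⊥ ∧
      (mordellCurve (-81675 : ℚ)).shaCorank 3 = 0 ∧ (mordellCurve (-81675 : ℚ)).selmerCorank 3 = 2 :=
  ⟨mordellWeilRank_curve, primaryComponent_sha_three, shaCorank_three, selmerCorank_three⟩

end XCubeSub81675

end Literature.NumberTheory.EllipticCurves
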